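import Literature.MathematicalPhysics.QuantumLattice.FermionQuasiFree
import Literature.Probability.LatticeModels.TorusFourierProofs
import Literature.Probability.LatticeModels.LatticeGreenRiemannSum
import HarnessLib

/-!
# The free Hubbard propagator on the torus in momentum space (BGM's `ĝ` at equal times)

Topic `MathematicalPhysics/QuantumLattice`. Third piece of the free (`U = 0`) layer under the
named fact `bgm_two_point_limit` (`HubbardFermiLiquid.lean`; Benfatto–Giuliani–Mastropietro,
Ann. Henri Poincaré 7 (2006) 809, Thm. 1.1) — WITHOUT importing that module (import hygiene: this
file and its importers `HubbardFreeCovariance`, `HubbardEffectiveAction(CT)`, … must not carry the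
unproved fact in their import closure; the two-point function `hubbardThermalTwoPoint` of the fact is
therefore not named here but appears unfolded, as the Gibbs correlation `thermalCorr β H_L c† c`, and
the `hubbardThermalTwoPoint`-named corollaries live in `HubbardFreePropagatorTwoPoint.lean`): after
`FermionQuasiFree.lean` (the finite-volume
free two-point function is the Fermi matrix `(1 + e^{βh_L})⁻¹` of the one-body Hamiltonian) this
file diagonalises the torus one-body Hamiltonian `h_L = hubbardOneBody (fermionTorusGraph d L) 1 μ`
by the characters of `(ℤ/Lℤ)^d` and obtains BGM's free propagator (1.4) (summed over the
Matsubara frequency, i.e. at equal times) as an explicit momentum sum. Everything is PROVED: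

* `exp_mulVec_of_mulVec_eq_smul` — `A v = c v ⟹ e^{A} v = e^{c} v` for complex matrices
  (`u ↦ e^{-uc} e^{uA} v` has zero derivative);
* `sum_ite_torusGraph_adj` — for `L ≥ 3` the torus-graph neighbours of `x` are the `2d` distinct
  points `x ± eᵢ` (`Σ_{y ∼ x} g(y) = Σᵢ (g(x+eᵢ) + g(x-eᵢ))`; false for `L ≤ 2`, where the two
  directions coincide), `sum_ite_torusGraph_adj_torusChar` — `Σ_{y ∼ x} χ_k(y) = 2(Σᵢ cos pᵢ) χ_k(x)`;
* `torusBand L k = -2 Σᵢ cos(2πkᵢ/L)`, `planeWave k τ = χ_k ⊗ e_τ`,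
  `hubbardOneBody_mulVec_planeWave` — `h_L (χ_k ⊗ e_τ) = (ε_L(k) - μ)(χ_k ⊗ e_τ)` (`L ≥ 3`);
* `fermiFunction β E = (1 + e^{βE})⁻¹`, `freeFermiMatrix` (the momentum-space candidate),
  `one_add_exp_mul_freeFermiMatrix`, `fermiMatrix_torus_eq_freeFermiMatrix` —
  `[(1 + e^{βh_L})⁻¹]_{(x,σ),(x',σ')} = δ_{σσ'} L^{-d} Σ_k χ_k(x - x') f_β(ε_L(k) - μ)` (right-inverse
  uniqueness: plane waves are eigenvectors, `f(E)(1 + e^{βE}) = 1`, characters are complete);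
* `thermalCorr_hubbardTorusWith_zero_interaction_eq_sum`,
  `thermalCorr_hubbardTorusWith_zero_interaction_eq_sum_latticeMomentum` — for `3 ≤ L` the `U = 0`
  two-point function `tr(e^{-βH_L} c†_{xσ} c_{yσ'})/tr(e^{-βH_L})`, `H_L = hubbardTorusWith 2 L 1 0 μ`,
  is `δ_{σσ'} L⁻² Σ_{k ∈ (ℤ/Lℤ)²} F_{β,μ,y-x}(2πk/L)` with the
  continuous (`continuous_freePropagatorIntegrand`) integrand
  `freePropagatorIntegrand β μ z p = e^{ip·z} f_β(-2Σᵢ cos pᵢ - μ)` (`torusChar_proj`: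
  `χ_k(z mod L) = e^{i(2πk/L)·z}`; `latticeMomentum_eq_cellCorner_add`: `2πk/L = c_k + π`), i.e.
  a Riemann sum over the momentum grid — whose `L → ∞` limit is then the Brillouin-zone
  integral (`BrillouinRiemannSum.tendsto_cornerRiemannSum`, assembled in a sibling file).

## Mathlib / tree search

Mathlib: `NormedSpace.exp`, `hasDerivAt_exp_smul_const'`, `is_const_of_deriv_eq_zero`,
`Matrix.inv_eq_right_inv`, `SimpleGraph.circulantGraph` (the tree's `torusGraph`),
`ZMod.stdAddChar_coe`; no lemma on `exp` of a matrix applied to an eigenvector was found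
(`lean search 'exp_mulVec|hasEigenvector.*exp'`). Tree: `torusChar`, `sum_torusChar_left`
(orthogonality), `torusChar_add_right/sub_right/re`, `latticeMomentum` (`TorusFourier(Proofs)`),
`cellCorner`, `gridStep` (`LatticeGreenRiemannSum`), `FermionTorus.equivTorusSite`,
`fermionTorusGraph_adj`, `torusGraph_adj_iff` (`HubbardModel`, `LatticeGraph`),
`thermalCorr_hamiltonianWith_zero`, `hubbardOneBody_apply` (`FermionQuasiFree`).

## References

* G. Benfatto, A. Giuliani, V. Mastropietro, *Fermi liquid behavior in the 2D Hubbard model at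
  low temperatures*, Ann. Henri Poincaré 7 (2006) 809–898, §1.2, eq. (1.4) (free propagator,
  `e₀(k) = 2 - cos k₁ - cos k₂` in their hopping-`½` convention) and §2.1, eq. (2.5).
  [BenfattoGiulianiMastropietro2006]
* S. Friedli, Y. Velenik, *Statistical Mechanics of Lattice Systems* (CUP 2017), §10.4 (Fourier
  analysis on the discrete torus). [FriedliVelenik2017]
-/

noncomputable section

open NormedSpace Matrix Finset Filter
open Literature.Probability.LatticeModels
open scoped Topology ComplexConjugate

namespace Literature.MathematicalPhysics.QuantumLattice

/-! ### The exponential of a matrix on an eigenvector -/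

section ExpEigen

variable {n : Type*} [Fintype n] [DecidableEq n]

section MulVecDeriv

open scoped Matrix.Norms.Operator

/-- `M ↦ M v` as a continuous linear map in the matrix. [folklore] -/
private def mulVecCLM (v : n → ℂ) : Matrix n n ℂ →L[ℂ] (n → ℂ) :=
  LinearMap.toContinuousLinearMap
    { toFun := fun M => M *ᵥ v
      map_add' := fun _ _ => Matrix.add_mulVec _ _ _
      map_smul' := fun _ _ => Matrix.smul_mulVec _ _ _ }

/-- `u ↦ e^{uA} v` is differentiable with derivative `A e^{uA} v`. [folklore] -/
private theorem hasDerivAt_exp_smul_mulVec (A : Matrix n n ℂ) (v : n → ℂ) (u : ℂ) :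
    HasDerivAt (fun w : ℂ => exp (w • A) *ᵥ v) ((A * exp (u • A)) *ᵥ v) u :=
  (mulVecCLM v).hasFDerivAt.comp_hasDerivAt u (hasDerivAt_exp_smul_const' (𝕂 := ℂ) A u)

end MulVecDeriv

/-- **The matrix exponential on an eigenvector**: `A v = c v ⟹ e^{A} v = e^{c} v`
(`u ↦ e^{-uc} e^{uA} v` is constant). [folklore] -/
theorem exp_mulVec_of_mulVec_eq_smul (A : Matrix n n ℂ) {v : n → ℂ} {c : ℂ}
    (hv : A *ᵥ v = c • v) : exp A *ᵥ v = Complex.exp c • v := by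
  set Ψ : ℂ → (n → ℂ) := fun u => Complex.exp (-(u * c)) • (exp (u • A) *ᵥ v) with hΨ
  have hΨd : ∀ u, HasDerivAt Ψ 0 u := by
    intro u
    have h1 : HasDerivAt (fun w : ℂ => Complex.exp (-(w * c))) (Complex.exp (-(u * c)) * -c) u := by
      have := ((hasDerivAt_id u).mul_const c).neg.cexp
      simpa using this
    have h2 := hasDerivAt_exp_smul_mulVec A v u
    have h := h1.smul h2
    have hcomm : A * exp (u • A) = exp (u • A) * A :=
      (((Commute.refl A).smul_left u).exp_left).eq.symm
    have key : Complex.exp (-(u * c)) • ((A * exp (u • A)) *ᵥ v) +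
        (Complex.exp (-(u * c)) * -c) • (exp (u • A) *ᵥ v) = 0 := by
      rw [hcomm, ← Matrix.mulVec_mulVec, hv, Matrix.mulVec_smul, smul_smul, ← add_smul]
      ring_nf
      simp
    rw [key] at h
    exact h
  have hconst : Ψ 1 = Ψ 0 :=
    is_const_of_deriv_eq_zero (fun u => (hΨd u).differentiableAt) (fun u => (hΨd u).deriv) 1 0
  have h0 : Ψ 0 = v := by simp [hΨ]
  have h1 : Ψ 1 = Complex.exp (-c) • (exp A *ᵥ v) := by simp [hΨ]
  rw [h0] at hconst
  rw [h1] at hconst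
  calc exp A *ᵥ v = Complex.exp c • (Complex.exp (-c) • (exp A *ᵥ v)) := by
        rw [smul_smul, ← Complex.exp_add, add_neg_cancel, Complex.exp_zero, one_smul]
    _ = Complex.exp c • v := by rw [hconst]

end ExpEigen

/-! ### Nearest-neighbour sums on the discrete torus `(ℤ/Lℤ)^d`, `L ≥ 3` -/

section TorusSums

variable {d L : ℕ} [NeZero L]

/-- For `L ≥ 3`, the neighbours of `x` in the torus graph are the `2d` DISTINCT points
`x ± eᵢ`: `Σ_{y ∼ x} g(y) = Σᵢ (g(x + eᵢ) + g(x - eᵢ))`. (For `L ≤ 2` the two directions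
coincide and the formula fails.) Friedli–Velenik 2017, §3.1. [folklore] -/
theorem sum_ite_torusGraph_adj (hL : 3 ≤ L) (x : TorusSite d L) (g : TorusSite d L → ℂ) :
    (∑ y, if (torusGraph d L).Adj x y then g y else 0) =
      ∑ i, (g (x + Pi.single i 1) + g (x - Pi.single i 1)) := by
  classical
  haveI : Fact (1 < L) := ⟨by omega⟩
  have h1 : (1 : ZMod L) ≠ 0 := one_ne_zero
  have h2 : (1 : ZMod L) + 1 ≠ 0 := by
    intro h
    have : ((2 : ℕ) : ZMod L) = 0 := by exact_mod_cast (by simpa [one_add_one_eq_two] using h)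
    rw [ZMod.natCast_eq_zero_iff] at this
    exact absurd (Nat.le_of_dvd two_pos this) (by omega)
  -- `eᵢ ≠ 0`, `eᵢ + eⱼ ≠ 0`, `eᵢ = eⱼ → i = j`
  have hsingle_ne : ∀ i : Fin d, (Pi.single i 1 : TorusSite d L) ≠ 0 := fun i h => by
    have := congrFun h i; simp [h1] at this
  have hsingle_inj : ∀ i j : Fin d, (Pi.single i 1 : TorusSite d L) = Pi.single j 1 → i = j := by
    intro i j h
    by_contra hij
    have := congrFun h i
    simp [hij, h1] at this
  have hsum_ne : ∀ i j : Fin d, (Pi.single i 1 : TorusSite d L) + Pi.single j 1 ≠ 0 := by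
    intro i j h
    have := congrFun h i
    by_cases hij : i = j
    · subst hij; simp [h2] at this
    · simp [Ne.symm hij, h1] at this
  -- the neighbourhood as a union of two injective images
  set Np : Finset (TorusSite d L) := univ.image fun i => x + Pi.single i 1 with hNp
  set Nm : Finset (TorusSite d L) := univ.image fun i => x - Pi.single i 1 with hNm
  have hadj : ∀ y, (torusGraph d L).Adj x y ↔ y ∈ Np ∪ Nm := by
    intro y
    rw [torusGraph_adj_iff, Finset.mem_union, Finset.mem_image, Finset.mem_image]
    constructor
    · rintro ⟨-, ⟨i, hi⟩ | ⟨i, hi⟩⟩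
      · exact Or.inl ⟨i, mem_univ _, hi.symm⟩
      · exact Or.inr ⟨i, mem_univ _, by rw [hi, add_sub_cancel_right]⟩
    · rintro (⟨i, -, hi⟩ | ⟨i, -, hi⟩)
      · refine ⟨fun hxy => hsingle_ne i ?_, Or.inl ⟨i, hi.symm⟩⟩
        have := hi; rw [← hxy] at this; simpa using this.symm
      · refine ⟨fun hxy => hsingle_ne i ?_, Or.inr ⟨i, by rw [← hi, sub_add_cancel]⟩⟩
        have := hi; rw [← hxy, sub_eq_self] at this; exact this
  have hdisj : Disjoint Np Nm := by
    rw [Finset.disjoint_left]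
    intro y hp hm
    rw [hNp, Finset.mem_image] at hp
    rw [hNm, Finset.mem_image] at hm
    obtain ⟨i, -, rfl⟩ := hp
    obtain ⟨j, -, hj⟩ := hm
    apply hsum_ne i j
    have := hj
    rw [sub_eq_iff_eq_add, add_assoc, left_eq_add] at this
    exact this
  have hinjp : Set.InjOn (fun i : Fin d => x + Pi.single i 1) (univ : Finset (Fin d)) :=
    fun i _ j _ h => hsingle_inj i j (add_left_cancel h)
  have hinjm : Set.InjOn (fun i : Fin d => x - Pi.single i 1) (univ : Finset (Fin d)) :=
    fun i _ j _ h => hsingle_inj i j (sub_right_injective h)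
  calc (∑ y, if (torusGraph d L).Adj x y then g y else 0)
      = ∑ y, if y ∈ Np ∪ Nm then g y else 0 := by
        refine Finset.sum_congr rfl fun y _ => ?_
        simp only [hadj]
    _ = ∑ y ∈ Np ∪ Nm, g y := by rw [Finset.sum_ite_mem, Finset.univ_inter]
    _ = ∑ y ∈ Np, g y + ∑ y ∈ Nm, g y := Finset.sum_union hdisj
    _ = ∑ i, g (x + Pi.single i 1) + ∑ i, g (x - Pi.single i 1) := by
        rw [hNp, hNm, Finset.sum_image hinjp, Finset.sum_image hinjm]
    _ = ∑ i, (g (x + Pi.single i 1) + g (x - Pi.single i 1)) := (Finset.sum_add_distrib).symm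

/-- A character at a unit vector: `χ_k(eᵢ) + conj χ_k(eᵢ) = 2 cos pᵢ`, `p = 2πk/L` (`L ≥ 2`).
Friedli–Velenik 2017, §10.4. [folklore] -/
theorem torusChar_single_add_conj (hL : 2 ≤ L) (k : TorusSite d L) (i : Fin d) :
    torusChar k (Pi.single i 1) + conj (torusChar k (Pi.single i 1)) =
      ((2 * Real.cos (latticeMomentum L k i) : ℝ) : ℂ) := by
  haveI : Fact (1 < L) := ⟨by omega⟩
  rw [Complex.add_conj, torusChar_re]
  push_cast
  congr 2
  rw [Finset.sum_eq_single i]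
  · simp [ZMod.val_one]
  · intro j _ hji
    simp [hji]
  · simp

/-- **Plane waves are eigenfunctions of the torus adjacency**: for `L ≥ 3`,
`Σ_{y ∼ x} χ_k(y) = (2 Σᵢ cos pᵢ) χ_k(x)`, `p = 2πk/L`. Friedli–Velenik 2017, §10.4
(Fourier symbol of the lattice Laplacian). [folklore] -/
theorem sum_ite_torusGraph_adj_torusChar (hL : 3 ≤ L) (k x : TorusSite d L) :
    (∑ y, if (torusGraph d L).Adj x y then torusChar k y else 0) =
      ((2 * ∑ i, Real.cos (latticeMomentum L k i) : ℝ) : ℂ) * torusChar k x := by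
  rw [sum_ite_torusGraph_adj hL]
  have hi : ∀ i, torusChar k (x + Pi.single i 1) + torusChar k (x - Pi.single i 1) =
      ((2 * Real.cos (latticeMomentum L k i) : ℝ) : ℂ) * torusChar k x := by
    intro i
    rw [torusChar_add_right, torusChar_sub_right, ← mul_add,
      torusChar_single_add_conj (by omega) k i, mul_comm]
  simp only [hi, ← Finset.sum_mul]
  push_cast
  rw [Finset.mul_sum]

end TorusSums

/-! ### Plane waves diagonalise the free Hubbard one-body Hamiltonian on the torus -/

section PlaneWaves

variable {d L : ℕ}

/-- The band function of the nearest-neighbour hopping `t = 1` on the torus `(ℤ/Lℤ)^d`: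
`ε_L(k) = -2 Σᵢ cos(2πkᵢ/L)` (BGM 2006 (1.4)(c) have `e₀ = 2 - cos k₁ - cos k₂` for hopping `½`
and the shifted `-Δ/2`; the tree's convention is hopping `1`, no shift).
[cite: BenfattoGiulianiMastropietro2006, eq. (1.4)] -/
def torusBand (L : ℕ) (k : TorusSite d L) : ℝ :=
  -2 * ∑ i, Real.cos (latticeMomentum L k i)

/-- The plane wave of momentum `k` and spin `τ` on the orbitals of the fermionic torus:
`(x, σ) ↦ [σ = τ] χ_k(x)`. BGM 2006 §2.1, eq. (2.5). [folklore] -/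
def planeWave [NeZero L] (k : TorusSite d L) (τ : Fin 2) : Orb (FermionTorus d L) → ℂ :=
  fun o => if (ofLex o).2 = τ then torusChar k (FermionTorus.toTorusSite (ofLex o).1) else 0

/-- `planeWave` in coordinates. [folklore] -/
theorem planeWave_orb [NeZero L] (k : TorusSite d L) (τ : Fin 2) (x : FermionTorus d L)
    (σ : Fin 2) :
    planeWave k τ (orb x σ) = if σ = τ then torusChar k (FermionTorus.toTorusSite x) else 0 := rfl

/-- Sums over the fermionic torus are sums over `(ℤ/Lℤ)^d`. [folklore] -/
theorem FermionTorus.sum_eq_sum_torusSite [NeZero L] {M : Type*} [AddCommMonoid M]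
    (f : FermionTorus d L → M) :
    ∑ x, f x = ∑ z : TorusSite d L, f (FermionTorus.ofTorusSite z) :=
  (Fintype.sum_equiv FermionTorus.equivTorusSite.symm _ _ fun _ => rfl).symm

/-- **Plane waves are eigenvectors of the free Hubbard one-body Hamiltonian on the torus**
(`L ≥ 3`): `h (χ_k ⊗ e_τ) = (ε_L(k) - μ) (χ_k ⊗ e_τ)` for
`h = hubbardOneBody (fermionTorusGraph d L) 1 μ`. BGM 2006 §1.2 (the free propagator is
diagonal in momentum, eq. (1.4)). [cite: BenfattoGiulianiMastropietro2006, eq. (1.4)] -/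
theorem hubbardOneBody_mulVec_planeWave [NeZero L] (hL : 3 ≤ L) (μ : ℝ) (k : TorusSite d L)
    (τ : Fin 2) :
    hubbardOneBody (fermionTorusGraph d L) 1 μ *ᵥ planeWave k τ =
      ((torusBand L k - μ : ℝ) : ℂ) • planeWave k τ := by
  funext o
  obtain ⟨⟨x, σ⟩, rfl⟩ : ∃ p : FermionTorus d L × Fin 2, toLex p = o := ⟨ofLex o, toLex_ofLex o⟩
  -- reindex the sum over orbitals as a double sum over sites and spins
  have hre : ∀ f : Orb (FermionTorus d L) → ℂ,
      ∑ o, f o = ∑ y : FermionTorus d L, ∑ σ' : Fin 2, f (orb y σ') := fun f => by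
    rw [← Fintype.sum_prod_type', ← (toLex : FermionTorus d L × Fin 2 ≃ _).sum_comp]
  -- the entries of `h` against the plane wave
  have hterm : ∀ (y : FermionTorus d L) (σ' : Fin 2),
      hubbardOneBody (fermionTorusGraph d L) 1 μ (orb x σ) (orb y σ') * planeWave k τ (orb y σ') =
        if σ = σ' then
          (if σ = τ then
            ((if (torusGraph d L).Adj x.toTorusSite y.toTorusSite then -torusChar k y.toTorusSite
                else 0) -
              (if x = y then (μ : ℂ) * torusChar k y.toTorusSite else 0))
          else 0)
        else 0 := by
    intro y σ'
    rw [hubbardOneBody_apply, planeWave_orb]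
    simp only [ofLex_toLex, fermionTorusGraph_adj, orb_eq_orb_iff]
    by_cases h1 : σ = σ'
    · subst h1
      by_cases h2 : σ = τ <;>
        by_cases h3 : (torusGraph d L).Adj x.toTorusSite y.toTorusSite <;> by_cases h4 : x = y <;>
        (simp [h2, h3, h4]; try ring)
    · simp [h1]
  change (hubbardOneBody (fermionTorusGraph d L) 1 μ *ᵥ planeWave k τ) (orb x σ) =
    ((torusBand L k - μ : ℝ) : ℂ) * planeWave k τ (orb x σ)
  simp only [Matrix.mulVec, dotProduct]
  rw [hre]
  simp only [hterm, Finset.sum_ite_eq, Finset.mem_univ, if_true]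
  rw [planeWave_orb]
  by_cases hσ : σ = τ
  · simp only [hσ, if_true, Finset.sum_sub_distrib, Finset.sum_ite_eq, Finset.mem_univ]
    rw [FermionTorus.sum_eq_sum_torusSite]
    simp only [FermionTorus.toTorusSite_ofTorusSite]
    have hneg : (∑ z : TorusSite d L,
        if (torusGraph d L).Adj x.toTorusSite z then -torusChar k z else 0) =
        -∑ z, (if (torusGraph d L).Adj x.toTorusSite z then torusChar k z else 0) := by
      rw [← Finset.sum_neg_distrib]
      exact Finset.sum_congr rfl fun z _ => by split_ifs <;> simp
    rw [hneg, sum_ite_torusGraph_adj_torusChar hL k x.toTorusSite]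
    unfold torusBand
    push_cast
    ring
  · simp [hσ]

end PlaneWaves

/-! ### The Fermi matrix of the torus in momentum space -/

section FermiMatrix

variable {d L : ℕ} [NeZero L]

/-- The Fermi–Dirac function `f_β(E) = 1 / (1 + e^{βE})`. Bratteli–Robinson II §5.2.4;
BGM 2006 §1.2. [folklore] -/
def fermiFunction (β E : ℝ) : ℝ := 1 / (1 + Real.exp (β * E))

/-- `f_β(E) (1 + e^{βE}) = 1`. [folklore] -/
theorem fermiFunction_mul_one_add_exp (β E : ℝ) :
    fermiFunction β E * (1 + Real.exp (β * E)) = 1 := by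
  unfold fermiFunction
  rw [one_div, inv_mul_cancel₀]
  positivity

/-- `1 + e^{βh}` on a plane wave: multiplication by `1 + e^{β(ε_L(k) - μ)}` (`L ≥ 3`). [folklore] -/
theorem one_add_exp_mulVec_planeWave (hL : 3 ≤ L) (β μ : ℝ) (k : TorusSite d L) (τ : Fin 2) :
    (1 + exp ((β : ℂ) • hubbardOneBody (fermionTorusGraph d L) 1 μ)) *ᵥ planeWave k τ =
      ((1 + Real.exp (β * (torusBand L k - μ)) : ℝ) : ℂ) • planeWave k τ := by
  have hv : ((β : ℂ) • hubbardOneBody (fermionTorusGraph d L) 1 μ) *ᵥ planeWave k τ =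
      ((β : ℂ) * ((torusBand L k - μ : ℝ) : ℂ)) • planeWave k τ := by
    rw [Matrix.smul_mulVec, hubbardOneBody_mulVec_planeWave hL, smul_smul]
  rw [Matrix.add_mulVec, Matrix.one_mulVec, exp_mulVec_of_mulVec_eq_smul _ hv]
  push_cast
  rw [add_smul, one_smul]

/-- The candidate Fermi matrix in momentum space:
`Φ_{(x,σ),(x',σ')} = δ_{σσ'} L^{-d} Σ_k χ_k(x - x') f_β(ε_L(k) - μ)`. BGM 2006 eq. (1.4)
(equal times). [folklore] -/
def freeFermiMatrix (β μ : ℝ) (L : ℕ) [NeZero L] :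
    Matrix (Orb (FermionTorus d L)) (Orb (FermionTorus d L)) ℂ :=
  Matrix.of fun o o' =>
    if (ofLex o).2 = (ofLex o').2 then
      ((L : ℂ) ^ d)⁻¹ * ∑ k : TorusSite d L,
        torusChar k ((ofLex o).1.toTorusSite - (ofLex o').1.toTorusSite) *
          (fermiFunction β (torusBand L k - μ) : ℂ)
    else 0

/-- Entries of `freeFermiMatrix`. [folklore] -/
theorem freeFermiMatrix_orb (β μ : ℝ) (x x' : FermionTorus d L) (σ σ' : Fin 2) :
    freeFermiMatrix β μ L (orb x σ) (orb x' σ') =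
      if σ = σ' then
        ((L : ℂ) ^ d)⁻¹ * ∑ k : TorusSite d L,
          torusChar k (x.toTorusSite - x'.toTorusSite) * (fermiFunction β (torusBand L k - μ) : ℂ)
      else 0 := rfl

/-- A column of `freeFermiMatrix` is a superposition of plane waves. [folklore] -/
theorem freeFermiMatrix_col (β μ : ℝ) (x' : FermionTorus d L) (σ' : Fin 2) :
    (fun o => freeFermiMatrix β μ L o (orb x' σ')) =
      ∑ k : TorusSite d L, (((L : ℂ) ^ d)⁻¹ * (fermiFunction β (torusBand L k - μ) : ℂ) *
        conj (torusChar k x'.toTorusSite)) • planeWave k σ' := by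
  funext o
  obtain ⟨⟨x, σ⟩, rfl⟩ : ∃ p : FermionTorus d L × Fin 2, toLex p = o := ⟨ofLex o, toLex_ofLex o⟩
  change freeFermiMatrix β μ L (orb x σ) (orb x' σ') = _
  rw [freeFermiMatrix_orb, Finset.sum_apply]
  simp only [Pi.smul_apply, planeWave_orb, smul_eq_mul, mul_ite, mul_zero]
  by_cases h : σ = σ'
  · simp only [h, if_true, Finset.mul_sum]
    refine Finset.sum_congr rfl fun k _ => ?_
    rw [torusChar_sub_right]
    ring
  · simp [h]

/-- **`(1 + e^{βh}) Φ = 1`** for the candidate `Φ = freeFermiMatrix` (`L ≥ 3`): plane waves are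
eigenvectors, `f_β(E)(1 + e^{βE}) = 1`, and the characters are complete. [folklore] -/
theorem one_add_exp_mul_freeFermiMatrix (hL : 3 ≤ L) (β μ : ℝ) :
    (1 + exp ((β : ℂ) • hubbardOneBody (fermionTorusGraph d L) 1 μ)) * freeFermiMatrix β μ L =
      1 := by
  set A := 1 + exp ((β : ℂ) • hubbardOneBody (fermionTorusGraph d L) 1 μ) with hA
  ext o o'
  obtain ⟨⟨x, σ⟩, rfl⟩ : ∃ p : FermionTorus d L × Fin 2, toLex p = o := ⟨ofLex o, toLex_ofLex o⟩
  obtain ⟨⟨x', σ'⟩, rfl⟩ : ∃ p : FermionTorus d L × Fin 2, toLex p = o' :=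
    ⟨ofLex o', toLex_ofLex o'⟩
  change (A *ᵥ fun o => freeFermiMatrix β μ L o (orb x' σ')) (orb x σ) =
    (1 : Matrix _ _ ℂ) (orb x σ) (orb x' σ')
  rw [freeFermiMatrix_col, Matrix.mulVec_sum]
  simp only [Matrix.mulVec_smul, hA, one_add_exp_mulVec_planeWave hL, smul_smul, Finset.sum_apply,
    Pi.smul_apply, planeWave_orb, smul_eq_mul, mul_ite, mul_zero, Matrix.one_apply, orb_eq_orb_iff]
  -- the coefficients: `L^{-d} f (1 + e) conj χ = L^{-d} conj χ`
  have hcoef : ∀ k : TorusSite d L,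
      ((L : ℂ) ^ d)⁻¹ * (fermiFunction β (torusBand L k - μ) : ℂ) *
          conj (torusChar k x'.toTorusSite) * (((1 + Real.exp (β * (torusBand L k - μ)) : ℝ) : ℂ)) =
        ((L : ℂ) ^ d)⁻¹ * conj (torusChar k x'.toTorusSite) := by
    intro k
    have := fermiFunction_mul_one_add_exp β (torusBand L k - μ)
    calc _ = ((L : ℂ) ^ d)⁻¹ * conj (torusChar k x'.toTorusSite) *
          ((fermiFunction β (torusBand L k - μ) * (1 + Real.exp (β * (torusBand L k - μ))) : ℝ) :
            ℂ) := by push_cast; ring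
      _ = _ := by rw [this]; push_cast; ring
  by_cases hσ : σ = σ'
  · simp only [hσ, if_true, and_true, hcoef]
    -- completeness of the characters
    have hsum : ∑ k : TorusSite d L, ((L : ℂ) ^ d)⁻¹ * conj (torusChar k x'.toTorusSite) *
        torusChar k x.toTorusSite =
        if x = x' then 1 else 0 := by
      have horth := sum_torusChar_left (x.toTorusSite - x'.toTorusSite)
      simp only [torusChar_sub_right] at horth
      have : ∑ k : TorusSite d L, conj (torusChar k x'.toTorusSite) * torusChar k x.toTorusSite =
          ∑ k, torusChar k x.toTorusSite * conj (torusChar k x'.toTorusSite) :=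
        Finset.sum_congr rfl fun k _ => mul_comm _ _
      have hinj : x.toTorusSite = x'.toTorusSite ↔ x = x' :=
        (FermionTorus.equivTorusSite (d := d) (L := L)).injective.eq_iff
      simp only [mul_assoc, ← Finset.mul_sum]
      rw [this, horth]
      simp only [sub_eq_zero, hinj, mul_ite, mul_zero, inv_mul_cancel₀ natCast_pow_ne_zero]
    rw [hsum]
  · simp [hσ]

/-- **The Fermi matrix of the free Hubbard model on the torus in momentum space** (`L ≥ 3`):
`[(1 + e^{βh_L})⁻¹]_{(x,σ),(x',σ')} = δ_{σσ'} L^{-d} Σ_k χ_k(x - x') f_β(ε_L(k) - μ)`,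
`h_L = hubbardOneBody (fermionTorusGraph d L) 1 μ`, `ε_L(k) = -2Σᵢ cos(2πkᵢ/L)`.
BGM 2006 eq. (1.4) (equal-time value, summed over `k₀`).
[cite: BenfattoGiulianiMastropietro2006, eq. (1.4)] -/
theorem fermiMatrix_torus_eq_freeFermiMatrix (hL : 3 ≤ L) (β μ : ℝ) :
    (1 + exp ((β : ℂ) • hubbardOneBody (fermionTorusGraph d L) 1 μ))⁻¹ = freeFermiMatrix β μ L :=
  Matrix.inv_eq_right_inv (one_add_exp_mul_freeFermiMatrix hL β μ)

end FermiMatrix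

/-! ### The momentum sum as a function of the lattice momenta `p = 2πk/L` -/

section Integrand

open Complex in
/-- A character of `(ℤ/Lℤ)^d` evaluated at the reduction of an integer vector is the plane wave
`e^{i p·z}` with `p = 2πk/L` (well defined modulo `L`). Friedli–Velenik 2017, §10.4. [folklore] -/
theorem torusChar_proj {d L : ℕ} [NeZero L] (k : TorusSite d L) (z : Site d) :
    torusChar k (Torus.proj L z) =
      Complex.exp (I * ∑ i, ((latticeMomentum L k i * z i : ℝ) : ℂ)) := by
  unfold torusChar
  rw [Finset.mul_sum, Complex.exp_sum]
  refine Finset.prod_congr rfl fun i _ => ?_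
  have hk : (k i : ZMod L) * Torus.proj L z i = (((k i).val * z i : ℤ) : ZMod L) := by
    push_cast
    rw [ZMod.natCast_zmod_val, Torus.proj_apply]
  rw [hk, ZMod.stdAddChar_coe]
  congr 1
  simp only [latticeMomentum]
  push_cast
  ring

/-- The lattice momentum is the shifted cell corner: `2πk/L = c_k + π`. [folklore] -/
theorem latticeMomentum_eq_cellCorner_add {d L : ℕ} (k : TorusSite d L) :
    latticeMomentum L k = cellCorner k + fun _ => Real.pi := by
  funext i
  simp only [latticeMomentum, cellCorner, gridStep, Pi.add_apply]
  ring

/-- BGM's free equal-time propagator integrand in the tree's convention (hopping `1`):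
`F_{β,μ,z}(p) = e^{i p·z} f_β(-2 Σᵢ cos pᵢ - μ)`, `z = y - x ∈ ℤ^d`. BGM 2006, eq. (1.4) (after
the Matsubara sum). [cite: BenfattoGiulianiMastropietro2006, eq. (1.4)] -/
def freePropagatorIntegrand {d : ℕ} (β μ : ℝ) (z : Site d) (p : Fin d → ℝ) : ℂ :=
  Complex.exp (Complex.I * ∑ i, ((p i * z i : ℝ) : ℂ)) *
    (fermiFunction β (-2 * ∑ i, Real.cos (p i) - μ) : ℂ)

/-- The free propagator integrand is continuous in the momentum. [folklore] -/
theorem continuous_freePropagatorIntegrand {d : ℕ} (β μ : ℝ) (z : Site d) :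
    Continuous (freePropagatorIntegrand β μ z) := by
  unfold freePropagatorIntegrand fermiFunction
  refine Continuous.mul (Complex.continuous_exp.comp (continuous_const.mul
    (continuous_finsetSum _ fun i _ => Complex.continuous_ofReal.comp
      ((continuous_apply i).mul continuous_const)))) (Complex.continuous_ofReal.comp ?_)
  refine continuous_const.div (continuous_const.add (Real.continuous_exp.comp
    (continuous_const.mul ((continuous_const.mul (continuous_finsetSum _ fun i _ =>
      Real.continuous_cos.comp (continuous_apply i))).sub continuous_const)))) fun p => ?_
  positivity

end Integrand



/-! ### The free two-point function as a Gibbs correlation of the torus Hamiltonian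

BGM's free propagator (1.4) at equal times for the Gibbs functional
`thermalCorr β H_L c†_{xσ} c_{yσ'}` of the free Hubbard torus Hamiltonian
`H_L = hubbardTorusWith 2 L 1 0 μ`, i.e. `hubbardThermalTwoPoint β 0 μ L x y σ σ'`
(`HubbardFermiLiquid.lean`) unfolded at `L ≠ 0`: the forms used downstream
(`HubbardFreePropagatorLimit`, `HubbardFreePropagatorPeriodization`); the
`hubbardThermalTwoPoint`-named versions are in `HubbardFreePropagatorTwoPoint.lean`. -/

section FreeTwoPointCorr

/-- **BGM's free propagator at equal times, finite volume** (Gibbs-functional form). For `L ≥ 3`,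
`tr(e^{-βH_L} c†_{xσ} c_{yσ'}) / tr(e^{-βH_L})` for the FREE (`U = 0`) Hubbard torus Hamiltonian is
`δ_{σσ'} L⁻² Σ_{k ∈ (ℤ/Lℤ)²} χ_k(y - x) f_β(ε_L(k) - μ)` (BGM 2006 eq. (1.4) after the Matsubara
sum, hopping-`1` convention). [cite: BenfattoGiulianiMastropietro2006, eq. (1.4)] -/
theorem thermalCorr_hubbardTorusWith_zero_interaction_eq_sum {L : ℕ} [NeZero L] (hL : 3 ≤ L)
    (β μ : ℝ) (x y : Site 2) (σ σ' : Fin 2) :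
    thermalCorr β (hubbardTorusWith 2 L 1 0 μ)
        (creation (orb (FermionTorus.ofTorusSite (Torus.proj L x)) σ))
        (annihilation (orb (FermionTorus.ofTorusSite (Torus.proj L y)) σ')) =
      if σ = σ' then
        ((L : ℂ) ^ 2)⁻¹ * ∑ k : TorusSite 2 L,
          torusChar k (Torus.proj L y - Torus.proj L x) * (fermiFunction β (torusBand L k - μ) : ℂ)
      else 0 := by
  have h0 : thermalCorr β (hubbardTorusWith 2 L 1 0 μ)
        (creation (orb (FermionTorus.ofTorusSite (Torus.proj L x)) σ))
        (annihilation (orb (FermionTorus.ofTorusSite (Torus.proj L y)) σ')) =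
      (1 + NormedSpace.exp ((β : ℂ) • hubbardOneBody (fermionTorusGraph 2 L) 1 μ))⁻¹
        (orb (FermionTorus.ofTorusSite (Torus.proj L y)) σ')
        (orb (FermionTorus.ofTorusSite (Torus.proj L x)) σ) := by
    -- `hubbardTorusWith 2 L 1 0 μ` is `hamiltonianWith (fermionTorusGraph 2 L) 1 0 μ` by `rfl`
    convert thermalCorr_hamiltonianWith_zero (fermionTorusGraph 2 L) β 1 μ
      (FermionTorus.ofTorusSite (Torus.proj L x)) (FermionTorus.ofTorusSite (Torus.proj L y)) σ σ'
      using 6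
    rfl
  rw [h0, fermiMatrix_torus_eq_freeFermiMatrix hL, freeFermiMatrix_orb]
  simp only [FermionTorus.toTorusSite_ofTorusSite, eq_comm]

/-- **The free Gibbs two-point correlation as a Riemann sum over the lattice momenta** (`L ≥ 3`):
`tr(e^{-βH_L} c†_{xσ} c_{yσ'}) / tr(e^{-βH_L}) = δ_{σσ'} L⁻² Σ_{k ∈ (ℤ/Lℤ)²} F_{β,μ,y-x}(2πk/L)` at
`U = 0`. BGM 2006, eq. (1.4). [cite: BenfattoGiulianiMastropietro2006, eq. (1.4)] -/
theorem thermalCorr_hubbardTorusWith_zero_interaction_eq_sum_latticeMomentum {L : ℕ} [NeZero L]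
    (hL : 3 ≤ L) (β μ : ℝ) (x y : Site 2) (σ σ' : Fin 2) :
    thermalCorr β (hubbardTorusWith 2 L 1 0 μ)
        (creation (orb (FermionTorus.ofTorusSite (Torus.proj L x)) σ))
        (annihilation (orb (FermionTorus.ofTorusSite (Torus.proj L y)) σ')) =
      if σ = σ' then
        ((L : ℂ) ^ 2)⁻¹ *
          ∑ k : TorusSite 2 L, freePropagatorIntegrand β μ (y - x) (latticeMomentum L k)
      else 0 := by
  rw [thermalCorr_hubbardTorusWith_zero_interaction_eq_sum hL]
  have hproj : Torus.proj L y - Torus.proj L x = Torus.proj L (y - x) := by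
    funext i; simp [Torus.proj]
  simp only [hproj, torusChar_proj, freePropagatorIntegrand, torusBand]

end FreeTwoPointCorr

end Literature.MathematicalPhysics.QuantumLattice
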